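import Summits.BirchSwinnertonDyer.BirchSwinnertonDyer.Theorems.BiquadraticEisensteinDescentDeuringGrossRowsB
import Summits.BirchSwinnertonDyer.BirchSwinnertonDyer.Theorems.BiquadraticEisensteinDescentDeuringRowEightThousandHolds
import Summits.BirchSwinnertonDyer.BirchSwinnertonDyer.Theorems.BiquadraticEisensteinDescentDeuringRowSeventeenTwentyEight
import HarnessLib

set_option linter.dupNamespace false -- `Summit.BirchSwinnertonDyer.BirchSwinnertonDyer.Theorems.…` (summit = sub)
set_option autoImplicit false

/-!
# BED route, «Deuring-ψ lane»: `Deuring_exists_heckeCharacter_of_maximalCM` from the CORE of the sextic row `y² = x³ + k`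
# (eight of nine rows by name; the ninth reduced to sixth-power-free `k`)

Route `BiquadraticEisensteinDescent` of `Summits/BirchSwinnertonDyer` (crux `EisensteinHeartFlatCMInertBadKPrime`,
stmt-BirchSwinnertonDyer-21341; also `InertBadAtThree`, 19225: both take the named fact
`Literature.NumberTheory.EllipticCurves.Deuring_exists_heckeCharacter_of_maximalCM` BY NAME in the conditional closers of
`stub_V2`). Cell `bsd-wall`, width seat `bsd-wall-cm-bed-w3` g17 (assembly), after w4 g17 (spine `deuring_of_core_at`, rows
`−3375, −32768, −884736, −884736000, −147197952000, −262537412640768000, 8000`), w3 g16 (row `1728`) and w1 g14/g15 (row data).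
THEOREMS ONLY.

The named fact (Silverman *ATAEC* II Thm. 9.2 + Thm. 10.5 (b): for every globally minimal `E/ℚ` with CM by a maximal order,
its CM field `K` and complex conjugation `c`, the Grössencharacter `ψ_{E/K}` with its five printed properties) is a nine-way
conjunction over `maximalCMJInvariants = {0, 1728, −3375, 8000, −32768, −884736, −884736000, −147197952000,
−262537412640768000}`. Eight rows are kernel theorems (`deuring_of_j_eq_*`). This file isolates the EXACT open content:

* `core_of_j_eq_zero_of_core_sextic` — the CORE («some Hecke character of type `(1,0)` of `K` has `L(s,ψ) = L(W,s)` on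
  `re s > 3/2`») for EVERY elliptic `W/ℚ` with `W.j = 0` follows from the CORE for the sextic twists `E^k : y² = x³ + k`
  with `k ∈ ℤ ∖ {0}` SIXTH-POWER-FREE: `W ≅ y² = x³ + B` (`Rubin1987.exists_smul_eq_of_j_eq_zero`, Silverman *AEC* X.5.4 (iii)),
  `B = k q⁶` (`DeuringHecke.rat_exists_eq_intCast_mul_pow 6`), `y² = x³ + k q⁶ ≅ y² = x³ + k` (`DeuringHecke.smul_sextic_model`),
  and `L`-series are isomorphism invariants (`LSeries_smul`);
* `deuring_of_j_eq_zero_of_core_sextic` — hence all five Deuring clauses for every globally minimal `W` with `j(W) = 0`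
  (`deuring_of_core_at`), granted that sextic CORE;
* `deuring_of_ne_zero` — UNCONDITIONAL: all five clauses for every globally minimal `W/ℚ` with
  `W.j ∈ maximalCMJInvariants`, `W.j ≠ 0` (the eight proved rows, by name);
* ★ `deuring_of_core_sextic` — `Deuring_exists_heckeCharacter_of_maximalCM` ITSELF from the sextic CORE alone.

So after this file the named fact is equivalent-in-practice to ONE explicit statement about the curves `y² = x³ + k`,
`k` sixth-power-free, over `K = ℚ(√−3)`: the Grössencharacter `𝔭 ↦ −(4k/π)₆⁻¹ π` (Ireland–Rosen Ch. 18 §7, Thm. 4′) in the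
tree's `IsGrossencharakter`/`heckeOfGross` currency, which is the unit of seat w1 g15 (`EisensteinSextic*`), to be consumed
through `core_of_datum_set`. HONEST STATUS: nothing here discharges the fact; BSD is not proved for any curve; 21341 / 19225
stay conditional (Katz / Hsieh binders) even once the fact holds.

References: [SilvermanATAEC1994] II Thm. 9.2, Cor. 10.4.1, Thm. 10.5 (b), Ex. 2.30–2.32; [SilvermanAEC2009] X.5 Prop. 5.4;
[IrelandRosen1990] Ch. 18 §§3, 7.
-/

noncomputable section

namespace Summit.BirchSwinnertonDyer.BirchSwinnertonDyer.Theorems.BiquadraticEisensteinDescentDeuringOfCore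

open scoped NumberField
open NumberField IsDedekindDomain WeierstrassCurve
  Literature.NumberTheory.GaloisRepresentations Literature.NumberTheory.EllipticCurves

/-! ## §1 The row `j = 0` reduced to sixth-power-free `k` -/

/-- **The CORE of Deuring's theorem for EVERY elliptic curve over `ℚ` with `j = 0`, from the CORE for the sextic twists
`E^k : y² = x³ + k`, `k ∈ ℤ ∖ {0}` sixth-power-free.** `W ≅ y² = x³ + B` with `B ∈ ℚˣ` (`Rubin1987.exists_smul_eq_of_j_eq_zero`),
`B = k q⁶` with `k ∈ ℤ` sixth-power-free (`DeuringHecke.rat_exists_eq_intCast_mul_pow`), `y² = x³ + k q⁶ ≅ y² = x³ + k`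
(`DeuringHecke.smul_sextic_model`), and `L(W, s)` is an isomorphism invariant (`LSeries_smul`), so a character pinned to `E^k`
is pinned to `W` (`core_of_LSeries_eq`). [cite: SilvermanAEC2009, X.5 Prop. 5.4 (iii)] [cite: SilvermanATAEC1994, Ch. II Thm. 10.5 (b)] -/
theorem core_of_j_eq_zero_of_core_sextic
    (hsextic : ∀ k : ℤ, k ≠ 0 → (∀ p : ℕ, p.Prime → ¬ (p : ℤ) ^ 6 ∣ k) →
      ∀ (K : Type) [Field K] [NumberField K], IsCMFieldOfJ K 0 →
        ∃ ψ : HeckeCharacter K, ψ.HasInfinityType (fun _ ↦ 1) (fun _ ↦ 0) ∧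
          ∀ s : ℂ, 3 / 2 < s.re → heckeLFunction ψ s = ((⟨0, 0, 0, 0, (k : ℚ)⟩ : WeierstrassCurve ℚ)).LSeries s)
    (W : WeierstrassCurve ℚ) [W.IsElliptic] (hjW : W.j = 0)
    (K : Type) [Field K] [NumberField K] (hK : IsCMFieldOfJ K W.j) :
    ∃ ψ : HeckeCharacter K, ψ.HasInfinityType (fun _ ↦ 1) (fun _ ↦ 0) ∧
      ∀ s : ℂ, 3 / 2 < s.re → heckeLFunction ψ s = W.LSeries s := by
  rw [hjW] at hK
  -- `W ≅ y² = x³ + B ≅ y² = x³ + k`, `k` sixth-power-free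
  obtain ⟨B, C, hB, hC⟩ := Rubin1987.exists_smul_eq_of_j_eq_zero hjW
  obtain ⟨k, q, hk, hq, hBeq, hfree⟩ := DeuringHecke.rat_exists_eq_intCast_mul_pow 6 (by norm_num) B hB
  have hcore := hsextic k hk hfree K hK
  -- `L(W, s) = L(E^k, s)`
  haveI hE1 : (C • W).IsElliptic := by infer_instance
  haveI hE2 : ((⟨0, 0, 0, 0, (k : ℚ) * q ^ 6⟩ : WeierstrassCurve ℚ)).IsElliptic := by rw [← hBeq, ← hC]; exact hE1
  have hL : W.LSeries = ((⟨0, 0, 0, 0, (k : ℚ)⟩ : WeierstrassCurve ℚ)).LSeries := by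
    rw [← DeuringHecke.smul_sextic_model (B := (k : ℚ)) hq, WeierstrassCurve.LSeries_smul, ← hBeq, ← hC,
      WeierstrassCurve.LSeries_smul]
  exact core_of_LSeries_eq hL hcore

/-- **Deuring's theorem (all five clauses of `Deuring_exists_heckeCharacter_of_maximalCM`) for every globally minimal `W/ℚ`
with `j(W) = 0`, GRANTED the CORE for the sextic twists `y² = x³ + k`, `k` sixth-power-free** (`core_of_j_eq_zero_of_core_sextic`
+ `deuring_of_core_at`): CM by `ℤ[ω]`. [cite: SilvermanATAEC1994, Ch. II Thm. 9.2, Cor. 10.4.1, Thm. 10.5 (b), Ex. 2.30–2.32]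
[cite: SilvermanAEC2009, X.5 Prop. 5.4 (iii)] -/
theorem deuring_of_j_eq_zero_of_core_sextic
    (hsextic : ∀ k : ℤ, k ≠ 0 → (∀ p : ℕ, p.Prime → ¬ (p : ℤ) ^ 6 ∣ k) →
      ∀ (K : Type) [Field K] [NumberField K], IsCMFieldOfJ K 0 →
        ∃ ψ : HeckeCharacter K, ψ.HasInfinityType (fun _ ↦ 1) (fun _ ↦ 0) ∧
          ∀ s : ℂ, 3 / 2 < s.re → heckeLFunction ψ s = ((⟨0, 0, 0, 0, (k : ℚ)⟩ : WeierstrassCurve ℚ)).LSeries s)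
    (W : WeierstrassCurve ℚ) [W.IsElliptic] [W.IsGloballyMinimal] (hjW : W.j = 0)
    (K : Type) [Field K] [NumberField K] (hK : IsCMFieldOfJ K W.j) (c : K ≃ₐ[ℚ] K) (hc : c ≠ 1) :
    ∃ ψ : HeckeCharacter K,
      ψ.HasInfinityType (fun _ ↦ 1) (fun _ ↦ 0) ∧
      IsHeckeConjEquivariant c ψ ∧
      (∀ w : HeightOneSpectrum (𝓞 K), ψ.IsUnramifiedAt w ↔ (W.baseChange K).HasGoodReductionAt w) ∧
      (∀ (p : ℕ) [Fact p.Prime], W.HasGoodReductionAtPrime p →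
        ∀ w : HeightOneSpectrum (𝓞 K), (p : 𝓞 K) ∈ w.asIdeal →
          ψ.IsUnramifiedAt w ∧
          (c • w ≠ w →
            ψ.valueAtUniformizer w + ψ.valueAtUniformizer (c • w) = (W.frobeniusTrace p : ℂ) ∧
            ψ.valueAtUniformizer w * ψ.valueAtUniformizer (c • w) = (p : ℂ)) ∧
          (c • w = w → W.frobeniusTrace p = 0 ∧ ψ.valueAtUniformizer w = -(p : ℂ))) ∧
      ∀ s : ℂ, 3 / 2 < s.re → heckeLFunction ψ s = W.LSeries s :=
  deuring_of_core_at W (by rw [hjW]; simp [maximalCMJInvariants]) K hK c hc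
    (core_of_j_eq_zero_of_core_sextic hsextic W hjW K hK)

/-! ## §2 The eight proved rows, by name -/

/-- **Deuring's theorem with the Grössencharacter, all five clauses, UNCONDITIONALLY, for every globally minimal `E/ℚ` with
CM by a maximal order OTHER than `ℤ[ω]`** (`W.j ∈ maximalCMJInvariants`, `W.j ≠ 0`): the eight kernel rows
`deuring_of_j_eq_1728 / _neg3375 / _8000 / _neg32768 / _neg884736 / _neg884736000 / _neg147197952000 /
_neg262537412640768000` by name. [cite: SilvermanATAEC1994, Ch. II Thm. 9.2, Cor. 10.4.1, Thm. 10.5 (b), Ex. 2.30–2.32] -/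
theorem deuring_of_ne_zero (W : WeierstrassCurve ℚ) [W.IsElliptic] [W.IsGloballyMinimal]
    (hj : W.j ∈ maximalCMJInvariants) (hj0 : W.j ≠ 0)
    (K : Type) [Field K] [NumberField K] (hK : IsCMFieldOfJ K W.j) (c : K ≃ₐ[ℚ] K) (hc : c ≠ 1) :
    ∃ ψ : HeckeCharacter K,
      ψ.HasInfinityType (fun _ ↦ 1) (fun _ ↦ 0) ∧
      IsHeckeConjEquivariant c ψ ∧
      (∀ w : HeightOneSpectrum (𝓞 K), ψ.IsUnramifiedAt w ↔ (W.baseChange K).HasGoodReductionAt w) ∧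
      (∀ (p : ℕ) [Fact p.Prime], W.HasGoodReductionAtPrime p →
        ∀ w : HeightOneSpectrum (𝓞 K), (p : 𝓞 K) ∈ w.asIdeal →
          ψ.IsUnramifiedAt w ∧
          (c • w ≠ w →
            ψ.valueAtUniformizer w + ψ.valueAtUniformizer (c • w) = (W.frobeniusTrace p : ℂ) ∧
            ψ.valueAtUniformizer w * ψ.valueAtUniformizer (c • w) = (p : ℂ)) ∧
          (c • w = w → W.frobeniusTrace p = 0 ∧ ψ.valueAtUniformizer w = -(p : ℂ))) ∧
      ∀ s : ℂ, 3 / 2 < s.re → heckeLFunction ψ s = W.LSeries s := by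
  simp only [maximalCMJInvariants, Finset.mem_insert, Finset.mem_singleton] at hj
  rcases hj with h | h | h | h | h | h | h | h | h
  · exact absurd h hj0
  · exact deuring_of_j_eq_1728 W h K hK c hc
  · exact deuring_of_j_eq_neg3375 W h K hK c hc
  · exact deuring_of_j_eq_8000 W h K hK c hc
  · exact deuring_of_j_eq_neg32768 W h K hK c hc
  · exact deuring_of_j_eq_neg884736 W h K hK c hc
  · exact deuring_of_j_eq_neg884736000 W h K hK c hc
  · exact deuring_of_j_eq_neg147197952000 W h K hK c hc
  · exact deuring_of_j_eq_neg262537412640768000 W h K hK c hc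

/-! ## §3 The named fact from the sextic CORE -/

/-- ★ **`Deuring_exists_heckeCharacter_of_maximalCM` FROM THE SEXTIC CORE ALONE.** If for every sixth-power-free
`k ∈ ℤ ∖ {0}` and every `K` with `IsCMFieldOfJ K 0` (`= ℚ(√−3)`) SOME Hecke character of `K` of infinity type `(1, 0)`
satisfies `L(s, ψ) = L(E^k, s)` on `re s > 3/2` for `E^k : y² = x³ + k` (Ireland–Rosen Ch. 18 §7: `ψ(𝔭) = −(4k/π)₆⁻¹ π`), then
Silverman's Deuring theorem with the Grössencharacter holds for EVERY maximal-order CM curve over `ℚ`: nine-way split on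
`maximalCMJInvariants`, the row `j = 0` by `deuring_of_j_eq_zero_of_core_sextic`, the other eight rows unconditionally
(`deuring_of_ne_zero`). [cite: SilvermanATAEC1994, Ch. II Thm. 9.2 and Thm. 10.5 (b) (p. 164–172)] [cite: IrelandRosen1990, Ch. 18 §7] -/
theorem deuring_of_core_sextic
    (hsextic : ∀ k : ℤ, k ≠ 0 → (∀ p : ℕ, p.Prime → ¬ (p : ℤ) ^ 6 ∣ k) →
      ∀ (K : Type) [Field K] [NumberField K], IsCMFieldOfJ K 0 →
        ∃ ψ : HeckeCharacter K, ψ.HasInfinityType (fun _ ↦ 1) (fun _ ↦ 0) ∧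
          ∀ s : ℂ, 3 / 2 < s.re → heckeLFunction ψ s = ((⟨0, 0, 0, 0, (k : ℚ)⟩ : WeierstrassCurve ℚ)).LSeries s) :
    Deuring_exists_heckeCharacter_of_maximalCM := by
  intro W _ _ hj K _ _ hK c hc
  by_cases hj0 : W.j = 0
  · exact deuring_of_j_eq_zero_of_core_sextic hsextic W hj0 K hK c hc
  · exact deuring_of_ne_zero W hj hj0 K hK c hc

end Summit.BirchSwinnertonDyer.BirchSwinnertonDyer.Theorems.BiquadraticEisensteinDescentDeuringOfCore

end
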